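import Literature.AlgebraicGeometry.AbelianSchemes.SerreTensorConstruction      -- ★ `serreTensor`, `serreAction`
import HarnessLib

/-!
# Transport of a FIBRE-LEVEL SERRE RECOGNITION PACKAGE along equal fibres (bookkeeping; [Conrad 2004] §7 Thm. 7.5, [Mumford 1970] §7 Thm. 4)

Topic `Literature/AlgebraicGeometry/AbelianSchemes`; namespace `Literature.AlgebraicGeometry.AbelianSchemes.AbelianSchemeOver`.  THEOREMS ONLY (no definition, no named
fact, no `instance`, no notation, no `sorry`).  Cell `hodgecm-mathlib` (D-0151), F0∕P6 «MOD» (crux hLiu418 = stmt-HodgeConjecture-24832, `--supports`, count-neutral): line L2,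
organ `stub_LAYERISO` — the JUNCTION between the two producers of a recognition package.  The package (the `hrec` binder of the L2 head
`layerIso_on_sheet_of_fibreRecognition`, the `pkg` binder of ★ (R9′) `exists_layerIso_of_fibreRecognition_of_rank`) is, for abelian schemes `A₁, A₂` over a field with
`𝒪`-actions `act₁, act₂` and a commutativity witness `hc` of `A₁`: a Serre presentation `(m, E, P, Q, N)` of an ideal with its row∕column laws and an EQUIVARIANT ISOMORPHISM of
group schemes `u : A₁ ⊗_E 𝔟 ⥲ A₂` (`serreTensor act₁ E`, Serre action versus `act₂`).  The fibres reaching the junction are DEFINITIONALLY but not SYNTACTICALLY equal (a fibre of a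
family read through ★ (ν8) carries other implicit base-change arguments than the same fibre read through the dock of the moduli tower), and unification inside the group-structure
instances of `IsMonHom u` is prohibitively expensive there; this file moves a package along EQUATIONS of the fibres (`A₁ = A₁′`, `HEq act₁ act₁′`, …) — the consumer supplies
`rfl`∕`HEq.rfl`, decided at the object level.  HC_CM is proved only modulo the printed citations (2 remaining named inputs hLiu418 24832, h413 24833) until rung 0 closes; this
file is generic bookkeeping and changes no count.

* `fibreRecognitionPkg_transport` — the transport (`subst` four times; the commutativity witnesses are proofs of a `Prop`, hence interchangeable).

## References
* [Conrad2004GrossZagier] B. Conrad, *Gross–Zagier revisited*, MSRI Publ. 49 (2004), §7 (Thm. 7.5) — Serre's tensor construction and its recognition.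
* [MumfordAV1970] D. Mumford, *Abelian Varieties* (1970), §7 Thm. 4 (p. 72).
-/

set_option autoImplicit false

noncomputable section

universe u

open CategoryTheory CategoryTheory.Limits AlgebraicGeometry MonoidalCategory CartesianMonoidalCategory
open scoped MonObj

namespace Literature.AlgebraicGeometry.AbelianSchemes

namespace AbelianSchemeOver

variable {S : Scheme.{u}} {O : Type*} [CommRing O]

/-- **TRANSPORT OF A FIBRE-LEVEL SERRE RECOGNITION PACKAGE ALONG EQUAL FIBRES.**  If `A₁ = A₁′`, `act₁ ≍ act₁′`, `A₂ = A₂′`, `act₂ ≍ act₂′`, then a package «Serre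
presentation `(m, E, P, Q, N)` + equivariant isomorphism `u : serreTensor act₁ E ⥲ A₂`» for `(A₁, act₁, A₂, act₂)` (commutativity witness `hc`) is one for
`(A₁′, act₁′, A₂′, act₂′)` (commutativity witness `hc′`).  Pure bookkeeping: the equations are `rfl` at every call site, the point being that they are decided on OBJECTS,
never inside group-structure instances. [cite: Conrad2004GrossZagier, §7 (Thm. 7.5)] [cite: MumfordAV1970, §7 Thm. 4 (p. 72)] -/
theorem fibreRecognitionPkg_transport {A₁ A₁' A₂ A₂' : AbelianSchemeOver S}
    {act₁ : A₁.RingAction O} {act₁' : A₁'.RingAction O} {act₂ : A₂.RingAction O} {act₂' : A₂'.RingAction O}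
    (hc : IsCommMonObj A₁.X) (hc' : IsCommMonObj A₁'.X)
    (h₁ : A₁ = A₁') (h₁a : HEq act₁ act₁') (h₂ : A₂ = A₂') (h₂a : HEq act₂ act₂')
    (h : ∃ (m : ℕ) (E : Matrix (Fin m) (Fin m) O) (hE : E * E = E) (P : Matrix (Fin m) (Fin 1) O) (Q : Matrix (Fin 1) (Fin m) O) (N : ℕ),
        N ≠ 0 ∧ E * P = P ∧ Q * E = Q ∧ Q * P = Matrix.scalar (Fin 1) (N : O) ∧ P * Q = Matrix.scalar (Fin m) (N : O) * E ∧
        (∀ j k', Q j k' ∈ Set.range fun k' => Q 0 k') ∧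
        (∀ c ∈ Set.range (fun k' => Q 0 k'), ∃ Pc : Matrix (Fin m) (Fin 1) O, E * Pc = Pc ∧ Pc * Q = c • E) ∧
        ∃ (u : (@serreTensor _ A₁ O _ act₁ hc m E hE).X ⟶ A₂.X) (_ : IsMonHom u) (_ : IsIso u),
          ∀ a : O, (@serreAction _ A₁ O _ act₁ hc m E hE).i a ≫ u = u ≫ act₂.i a) :
    ∃ (m : ℕ) (E : Matrix (Fin m) (Fin m) O) (hE : E * E = E) (P : Matrix (Fin m) (Fin 1) O) (Q : Matrix (Fin 1) (Fin m) O) (N : ℕ),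
        N ≠ 0 ∧ E * P = P ∧ Q * E = Q ∧ Q * P = Matrix.scalar (Fin 1) (N : O) ∧ P * Q = Matrix.scalar (Fin m) (N : O) * E ∧
        (∀ j k', Q j k' ∈ Set.range fun k' => Q 0 k') ∧
        (∀ c ∈ Set.range (fun k' => Q 0 k'), ∃ Pc : Matrix (Fin m) (Fin 1) O, E * Pc = Pc ∧ Pc * Q = c • E) ∧
        ∃ (u : (@serreTensor _ A₁' O _ act₁' hc' m E hE).X ⟶ A₂'.X) (_ : IsMonHom u) (_ : IsIso u),
          ∀ a : O, (@serreAction _ A₁' O _ act₁' hc' m E hE).i a ≫ u = u ≫ act₂'.i a := by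
  subst h₁ h₂
  cases h₁a
  cases h₂a
  exact h

end AbelianSchemeOver

end Literature.AlgebraicGeometry.AbelianSchemes

end
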